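import Summits.AtomisticToContinuum.Crystallization.Theorems.OverbindingBudgetAffineNearSkeleton

/-!
# RD0c through BLOCK-MEAN equilibria — the wall-free sibling of the cell skeleton (lens-4 g46, critic row 696 (e)(iii))

Leaf decomposed (unchanged): RD0c `NearReferenceCriticalFloor η R Rc δm ρ₁ θ θ₀ κ₁` (tree `…AffineNearCritical.lean`, p840788) — «some
admissible reference `z` with `firstSum Near G y z = 0` satisfies N's floor».  The skeleton line (tree `…AffineNearSkeleton.lean`, p841460)
makes `firstSum` vanish by CLAMPING: `z = y` on thin walls, `classForce z = 0` on the cells.  Its sharpened doubt (g46 memo §5) lives exactly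
on the walls: there `z` is the RAW `y`, and thin loaded layers of `y` adjacent to a wall meet the floor at `O(1)` ratios.

This sibling removes the walls.  A BLOCK SYSTEM cuts the `ℓ`-deep clampable near interior into fat blocks of diameter `≤ ℓ` (no gaps, no pinned
sites except the `ℓ`-collar); a BLOCK-MEAN EQUILIBRIUM is a reference `z`, free on the whole block region `U`, whose class force is
BLOCK-CONSTANT (`classForce z k = Λ_b` on block `b` — the Lagrange multipliers of the constraints) and whose displacement has ZERO MEAN on every
block (`Σ_{k ∈ b} (y k − z k) = 0`).  Then the first-order identity of the tree (`firstSum = Σ_k ⟪y k − z k, classForce z k⟫`) gives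
`firstSum = Σ_b ⟪Σ_{k∈b} (y k − z k), Λ_b⟫ = 0` EXACTLY (`firstSum_eq_zero_of_blockCritical`, PROVED) — with `z` relaxed everywhere deep.

Pieces: CPμ `NearBlockEquilibrium` (existence of an admissible block-mean equilibrium: finite-dimensional minimisation of the class energy over
the compact convex admissible set under `3·#blocks` linear constraints; interiority from K_at⁰) and R0μ `NearBlockFloor` (N's floor for every
admissible block-mean equilibrium).  What R0μ must absorb instead of raw walls: the block-constant LOADS `Λ_b` (net boundary flux of block `b`
over `#b ≥ c·ℓ³`, i.e. `|Λ_b| ≲ C ε₁/ℓ`) and their jumps across block faces — smooth on scale `ℓ`, kink leak `∝ ε₁²·ℓ` per block against the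
budget `ν·Q₁ ∝ ν·ε₁²·ℓ³` per block: inside the scale order `ν → ℓ₀(ν)` of RD0c.  UNDECIDED like R0; its doubt is the size of `Λ` when `Q₁(y, z)`
is small, not a raw-`y` feature.  Seam PROVED; record cone `tbdsg_of_nearBlockMean_record` = LINE cone (cone of record unchanged).
Sources: lens-4 g45 memo §6 / g46 memo §6; Jaffard 1990 Prop. 3 (exponential locality of inverses of well-conditioned banded matrices — the
multiplier response), E–Ming 2007 §§4–6, Ortner–Theil 2013 Thm 3.3, Ehrlacher–Ortner–Shapeev 2016 §2.
-/

namespace Summit.AtomisticToContinuum.Crystallization.Theorems.OverbindingBudgetAffineNearCluster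

open scoped BigOperators Classical
open Literature.MathematicalPhysics.StatisticalMechanics
open Literature.Geometry.DiscreteGeometry (nearestDist)
open Summit.AtomisticToContinuum.Crystallization.Theses.OverbindingBudget (RobustDefectLimitWindows)
open Summit.AtomisticToContinuum.Crystallization.Theses.PricedLinkCensus (ChargedEnergyGap)
open Summit.AtomisticToContinuum.Crystallization.Theorems.OverbindingBudgetGradedBareness (CleanlessExcessT)
open Summit.AtomisticToContinuum.Crystallization.Theorems.OverbindingBudgetCoherentCut (CoherentResidual)
open Summit.AtomisticToContinuum.Crystallization.Theorems.OverbindingBudgetTwoShellShape (TwoShellShape)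
open Summit.AtomisticToContinuum.Crystallization.Theorems.OverbindingBudgetBalancedCensusStatements
open Summit.AtomisticToContinuum.Crystallization.Theorems.OverbindingBudgetBalancedCensusRecord
open Summit.AtomisticToContinuum.Crystallization.Theorems.OverbindingBudgetHarmonicNormalForm
open Summit.AtomisticToContinuum.Crystallization.Theorems.OverbindingBudgetLocalHarmonicCertificate
open Summit.AtomisticToContinuum.Crystallization.Theorems.OverbindingBudgetAffineLadder
open Summit.AtomisticToContinuum.Crystallization.Theorems.OverbindingBudgetAffineLocalisation

variable {N : ℕ}
local notation "E3" => EuclideanSpace ℝ (Fin 3)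

/-! ## §1  Block systems and block-mean criticality -/

/-- **Block system** of scale `ℓ` (distances in `y`): the free set `U` lies in the clampable near interior `I := nearInterior Rc` and a
labelling `c` cuts it into BLOCKS with (2) every block of `y`-diameter `≤ ℓ`; (3) FAT-OR-PERIPHERAL: every free site lies within `ℓ` of a
non-clampable site, or its block contains a FULL BALL (all sites within `ℓ/8` of some free `m` of the same block are free and in that block);
(4) COVER: every clampable site NOT in `U` lies within `ℓ` of a non-clampable site — NO WALLS: outside the `ℓ`-collar everything is free.
Realised (CPμ's burden) by the clampable sites of the grid cubes of side `ℓ/2` whose `ℓ/8`-ball about the site nearest the cube centre is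
entirely clampable; every other clampable site is within `(√3/2 + 1/8)·ℓ < ℓ` of a non-clampable one. [this file] -/
def BlockSystem (ℓ Rc θ₀ ρ₁ ε₁ θ δ : ℝ) (y : Fin N → E3) (U : Finset (Fin N)) (c : Fin N → ℕ) : Prop :=
  U ⊆ nearInterior Rc θ₀ ρ₁ ε₁ θ δ y ∧
    (∀ i ∈ U, ∀ j ∈ U, c i = c j → dist (y i) (y j) ≤ ℓ) ∧
    (∀ i ∈ U, (∃ b, b ∉ nearInterior Rc θ₀ ρ₁ ε₁ θ δ y ∧ dist (y i) (y b) ≤ ℓ) ∨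
      ∃ m ∈ U, c m = c i ∧ ∀ j, dist (y j) (y m) ≤ ℓ / 8 → j ∈ U ∧ c j = c i) ∧
    (∀ k ∈ nearInterior Rc θ₀ ρ₁ ε₁ θ δ y, k ∉ U → ∃ b, b ∉ nearInterior Rc θ₀ ρ₁ ε₁ θ δ y ∧ dist (y k) (y b) ≤ ℓ)

/-- **Block-mean critical:** the class force of `z` (classes `Near y`, `G y`) is BLOCK-CONSTANT on `U` (`= Λ (c k)`, the multipliers) and the
displacement `y − z` has ZERO SUM on every block — the Lagrange conditions of minimising the class energy under the block-mean constraints. [this file] -/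
def BlockCritical (θ₀ ρ₁ ε₁ θ δ : ℝ) (y z : Fin N → E3) (U : Finset (Fin N)) (c : Fin N → ℕ) : Prop :=
  ∃ Λ : ℕ → E3, (∀ k ∈ U, classForce (nearSet θ₀ ρ₁ ε₁ θ δ y) (goodSet ρ₁ ε₁ θ δ y) z k = Λ (c k)) ∧
    ∀ b, ∑ k ∈ U.filter (fun k => c k = b), (y k - z k) = 0

/-- **Block-mean equilibria have no first order (PROVED):** if `y − z` is supported in `U` and `z` is block-mean critical on `U`, then
`firstSum Near G y z = Σ_b ⟪Σ_{k ∈ b} (y k − z k), Λ_b⟫ = 0`. [this file] -/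
theorem firstSum_eq_zero_of_blockCritical {θ₀ ρ₁ ε₁ θ δ : ℝ} {y z : Fin N → E3} {U : Finset (Fin N)} {c : Fin N → ℕ}
    (hsupp : ∀ k, y k ≠ z k → k ∈ U) (hcrit : BlockCritical θ₀ ρ₁ ε₁ θ δ y z U c) :
    firstSum (nearSet θ₀ ρ₁ ε₁ θ δ y) (goodSet ρ₁ ε₁ θ δ y) y z = 0 := by
  obtain ⟨Λ, hΛ, hmean⟩ := hcrit
  rw [firstSum_eq_sum_inner_classForce]
  have hU : ∑ k, inner ℝ (y k - z k) (classForce (nearSet θ₀ ρ₁ ε₁ θ δ y) (goodSet ρ₁ ε₁ θ δ y) z k)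
      = ∑ k ∈ U, inner ℝ (y k - z k) (Λ (c k)) := by
    rw [← Finset.sum_subset (Finset.subset_univ U)]
    · exact Finset.sum_congr rfl fun k hk => by rw [hΛ k hk]
    · intro k _ hk
      have hyz : y k = z k := by
        by_contra h
        exact hk (hsupp k h)
      rw [hyz, sub_self, inner_zero_left]
  rw [hU, ← Finset.sum_fiberwise_of_maps_to (g := c) (t := U.image c) fun k hk => Finset.mem_image_of_mem c hk]
  refine Finset.sum_eq_zero fun b _ => ?_
  calc ∑ k ∈ U.filter (fun k => c k = b), inner ℝ (y k - z k) (Λ (c k))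
      = ∑ k ∈ U.filter (fun k => c k = b), inner ℝ (y k - z k) (Λ b) :=
          Finset.sum_congr rfl fun k hk => by rw [(Finset.mem_filter.mp hk).2]
    _ = inner ℝ (∑ k ∈ U.filter (fun k => c k = b), (y k - z k)) (Λ b) := (sum_inner _ _ _).symm
    _ = 0 := by rw [hmean b, inner_zero_left]

/-- Degenerate case, forward (PROVED): an `ℓ`-thin clampable interior carries the EMPTY block system. [this file] -/
theorem blockSystem_empty {ℓ Rc θ₀ ρ₁ ε₁ θ δ : ℝ} {y : Fin N → E3} (c : Fin N → ℕ)
    (h : ∀ k ∈ nearInterior Rc θ₀ ρ₁ ε₁ θ δ y, ∃ b, b ∉ nearInterior Rc θ₀ ρ₁ ε₁ θ δ y ∧ dist (y k) (y b) ≤ ℓ) :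
    BlockSystem ℓ Rc θ₀ ρ₁ ε₁ θ δ y ∅ c :=
  ⟨Finset.empty_subset _, by simp, by simp, fun k hk _ => h k hk⟩

/-- Degenerate case, converse (PROVED): the empty block system forces an `ℓ`-thin clampable interior (clause (4)). [this file] -/
theorem nearInterior_thin_of_blockSystem_empty {ℓ Rc θ₀ ρ₁ ε₁ θ δ : ℝ} {y : Fin N → E3} {c : Fin N → ℕ}
    (h : BlockSystem ℓ Rc θ₀ ρ₁ ε₁ θ δ y ∅ c) :
    ∀ k ∈ nearInterior Rc θ₀ ρ₁ ε₁ θ δ y, ∃ b, b ∉ nearInterior Rc θ₀ ρ₁ ε₁ θ δ y ∧ dist (y k) (y b) ≤ ℓ :=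
  fun k hk => h.2.2.2 k hk (by simp)

/-- `z = y` is block-mean critical on the empty system (multipliers irrelevant) and supported in it (PROVED, trivial). [this file] -/
theorem blockCritical_empty {θ₀ ρ₁ ε₁ θ δ : ℝ} (y : Fin N → E3) (c : Fin N → ℕ) :
    BlockCritical θ₀ ρ₁ ε₁ θ δ y y ∅ c ∧ ∀ k, y k ≠ y k → k ∈ (∅ : Finset (Fin N)) :=
  ⟨⟨fun _ => 0, fun k hk => absurd hk (by simp), fun b => by simp⟩, fun k hk => absurd rfl hk⟩

/-- **No deep pinned site (PROVED, = clause (4)):** in a block system a clampable site deeper than `ℓ` is free — the feature the skeleton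
line lacks (there, deep pinned walls exist by design). [this file] -/
theorem mem_of_blockSystem_of_deep {ℓ Rc θ₀ ρ₁ ε₁ θ δ : ℝ} {y : Fin N → E3} {U : Finset (Fin N)} {c : Fin N → ℕ}
    (h : BlockSystem ℓ Rc θ₀ ρ₁ ε₁ θ δ y U c) {k : Fin N} (hk : k ∈ nearInterior Rc θ₀ ρ₁ ε₁ θ δ y)
    (hdeep : ∀ b, b ∉ nearInterior Rc θ₀ ρ₁ ε₁ θ δ y → ℓ < dist (y k) (y b)) : k ∈ U := by
  by_contra hkU
  obtain ⟨b, hb, hbd⟩ := h.2.2.2 k hk hkU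
  exact absurd hbd (not_le.mpr (hdeep b hb))

/-! ## §2  The two pieces -/

/-- **CPμ · `NearBlockEquilibrium η R Rc δm ρ₁ θ θ₀`** (NEW · TRUE-type · ATTACKABLE-M).  Given K_at⁰ and R_aff: there is `ℓ₁` such that for
every `ℓ ≥ ℓ₁` some `ε₀ > 0` works for all `ε₁ ≤ ε₀` and all windows: every injective configuration admits a block system `(U, c)` of scale `ℓ`
and a BLOCK-MEAN EQUILIBRIUM `z` — `z = y` off `U`, block-mean critical on `U`, `RefAdmissible`.  Construction: grid cubes of side `ℓ/2` (fat test
as in `BlockSystem`); `z` := a minimiser of the class energy `½·pairSum Near G` over `{z : z = y off U, Σ_{k∈b}(z k − y k) = 0 ∀ b, charts (d)}` —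
compact, convex, finite-dimensional; K_at⁰ on each block (zero-mean fields: Poincaré on fat blocks of diameter `≤ ℓ`) gives
`sup |∇(z − y)| ≤ C ε₁ ℓ^4/μ₁`, so for `ε₁ ≤ ε₀(ℓ)` the minimiser is interior and the Lagrange conditions are `BlockCritical`.  WHY IT MIGHT FAIL:
the chart room `η − θ₀ − C ε₁` of `RefAdmissible` (d) at the record literals — as CP; nothing block-specific. [lens-4 g46; E–Ming 2007 §§4–6,
Ortner–Theil 2013 Thm 3.3, Ehrlacher–Ortner–Shapeev 2016 §2] -/
def NearBlockEquilibrium (η R Rc δm ρ₁ θ θ₀ : ℝ) : Prop :=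
  (∃ μ₁ μR : ℝ, 0 < μ₁ ∧ 0 < μR ∧ PureMarginStabilityAt η μ₁ μR R) → AffineChartStraightening →
    ∃ ℓ₁ : ℝ, ∀ ℓ : ℝ, ℓ₁ ≤ ℓ →
      ∃ ε₀ : ℝ, 0 < ε₀ ∧ ∀ ε₁ : ℝ, 0 < ε₁ → ε₁ ≤ ε₀ → ∀ δ : ℝ, 0 < δ → δ ≤ 2 →
        ∀ (N : ℕ) (y : Fin N → E3), Function.Injective y →
          ∃ (U : Finset (Fin N)) (c : Fin N → ℕ) (z : Fin N → E3), BlockSystem ℓ Rc θ₀ ρ₁ ε₁ θ δ y U c ∧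
            (∀ k, y k ≠ z k → k ∈ U) ∧ BlockCritical θ₀ ρ₁ ε₁ θ δ y z U c ∧ RefAdmissible η R Rc δm θ₀ ρ₁ ε₁ θ δ y z

/-- **R0μ · `NearBlockFloor η R Rc δm ρ₁ θ θ₀ κ₁`** (NEW · TRUE-type on paper · ATTACKABLE-L · UNDECIDED; the NORMAL-FORM half: «no
counterexample among block-mean equilibria»).  Given K_at⁰ and R_aff: for every `ν > 0` there is `ℓ₀(ν)` such that for every `ℓ ≥ ℓ₀` some
`ε₀ > 0` works (all `ε₁ ≤ ε₀`, all windows, some `C ≥ 0`): for EVERY injective `y`, EVERY block system `(U, c)` of scale `ℓ` and EVERY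
admissible block-mean equilibrium `z` on it, `#Near·e⋆ − C·#Gᶜ − κ₁·#Far − ν·Q₁(y, z) ≤ ½·pairSum Near G z`.
What is floored, truthfully: configurations RELAXED on the whole `ℓ`-deep near matter under BLOCK-CONSTANT LOADS `Λ_b` (`|Λ_b| = |net flux
through ∂b|/#b ≲ C ε₁/ℓ` on fat blocks) with zero-mean displacement per block, equal to the raw `y` only on the `ℓ`-collar (chargeable,
`#collar ≤ C(ℓ)·(#Far + #Gᶜ)`, loss `≤ C ε₁` each).  Versus R0: no raw walls, hence no wall-adjacent thin-layer doubt; instead the load field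
`Λ` — smooth on scale `ℓ`, kink leak `∝ ε₁²·ℓ` per block against `ν·Q₁ ∝ ν·ε₁²·ℓ³` when `|∇(y − z)| ≍ ε₁`.  WHY IT MIGHT FAIL: zero per-site
budget in the deep bulk; the one block-specific leak is the `Λ`-work at SECOND order when `Q₁(y, z) ≪ ε₁²·#U` (a `y` already almost relaxed
but incompatible at scale `ℓ`): then `Λ` must be shown `∝` the same mismatch that feeds `Q₁` (locality of the constrained response, Jaffard
1990 Prop. 3) — unproved. [lens-4 g46; Blanc–Le Bris–Lions 2002, E–Ming 2007 Thm 2.2, Theil 2006 / Flatley–Theil 2015, Hudson–Ortner 2014 §4] -/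
def NearBlockFloor (η R Rc δm ρ₁ θ θ₀ κ₁ : ℝ) : Prop :=
  (∃ μ₁ μR : ℝ, 0 < μ₁ ∧ 0 < μR ∧ PureMarginStabilityAt η μ₁ μR R) → AffineChartStraightening →
    ∀ ν : ℝ, 0 < ν → ∃ ℓ₀ : ℝ, ∀ ℓ : ℝ, ℓ₀ ≤ ℓ →
      ∃ ε₀ : ℝ, 0 < ε₀ ∧ ∀ ε₁ : ℝ, 0 < ε₁ → ε₁ ≤ ε₀ → ∀ δ : ℝ, 0 < δ → δ ≤ 2 →
        ∃ C : ℝ, 0 ≤ C ∧ ∀ (N : ℕ) (y : Fin N → E3), Function.Injective y →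
          ∀ (U : Finset (Fin N)) (c : Fin N → ℕ) (z : Fin N → E3), BlockSystem ℓ Rc θ₀ ρ₁ ε₁ θ δ y U c →
            (∀ k, y k ≠ z k → k ∈ U) → BlockCritical θ₀ ρ₁ ε₁ θ δ y z U c → RefAdmissible η R Rc δm θ₀ ρ₁ ε₁ θ δ y z →
              ((nearSet θ₀ ρ₁ ε₁ θ δ y).card : ℝ) * (⨅ Q : PeriodicConfiguration 3, Q.energyPerParticle lennardJones)
                - C * (((goodSet ρ₁ ε₁ θ δ y)ᶜ).card : ℝ) - κ₁ * ((farSet θ₀ ρ₁ ε₁ θ δ y).card : ℝ)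
                - ν * dispGradSum (101 / 100) (nearSet θ₀ ρ₁ ε₁ θ δ y) (goodSet ρ₁ ε₁ θ δ y) y z
                ≤ 1 / 2 * pairSum (nearSet θ₀ ρ₁ ε₁ θ δ y) (goodSet ρ₁ ε₁ θ δ y) z

/-! ## §3  The seam (PROVED) and the record cone -/

/-- **SEAM (PROVED): K-side → CPμ → R0μ → RD0c** — scale `max ℓ₀(ν) ℓ₁`, `ε₀ := min`, `firstSum = 0` by `firstSum_eq_zero_of_blockCritical`. [this file] -/
theorem nearReferenceCritical_of_blockMean {η R Rc δm ρ₁ θ θ₀ κ₁ : ℝ}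
    (hK : ∃ μ₁ μR : ℝ, 0 < μ₁ ∧ 0 < μR ∧ PureMarginStabilityAt η μ₁ μR R)
    (hCP : NearBlockEquilibrium η R Rc δm ρ₁ θ θ₀) (hR0 : NearBlockFloor η R Rc δm ρ₁ θ θ₀ κ₁) :
    NearReferenceCriticalFloor η R Rc δm ρ₁ θ θ₀ κ₁ := by
  intro hR ν hν
  obtain ⟨ℓ₁, hCP'⟩ := hCP hK hR
  obtain ⟨ℓ₀, hR0'⟩ := hR0 hK hR ν hν
  obtain ⟨ε₀a, hε₀a, hA⟩ := hCP' (max ℓ₀ ℓ₁) (le_max_right _ _)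
  obtain ⟨ε₀b, hε₀b, hB⟩ := hR0' (max ℓ₀ ℓ₁) (le_max_left _ _)
  refine ⟨min ε₀a ε₀b, lt_min hε₀a hε₀b, fun ε₁ hε₁ hle δ hδ hδ2 => ?_⟩
  obtain ⟨C, hC, hB'⟩ := hB ε₁ hε₁ (hle.trans (min_le_right _ _)) δ hδ hδ2
  refine ⟨C, hC, fun N y hy => ?_⟩
  obtain ⟨U, c, z, hbs, hsupp, hcrit, hadm⟩ := hA ε₁ hε₁ (hle.trans (min_le_left _ _)) δ hδ hδ2 N y hy
  exact ⟨z, hadm, firstSum_eq_zero_of_blockCritical hsupp hcrit, hB' N y hy U c z hbs hsupp hcrit hadm⟩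

/-- **LINE CONE through block-mean equilibria at the record literals** `(η, R, Rc, δm, ρ₁, θ, θ₀, κ₁) = (3/2000, 4, 6, 1/1000, 12, 1/25,
1/2000, 1/(4·10⁷))` through the tree's cone of record `tbdsg_of_nearCritical_record'_bt_d` (p840951):
`K_at⁰ ∧ R_aff ∧ CPμ ∧ R0μ ∧ N2 ∧ Z ∧ M ⟹ TameBalancedDeepScaleGap (122/125) 0 4 (3/50) (1/450)`. [this file] -/
theorem tbdsg_of_nearBlockMean_record
    (hK : ∃ μ₁ μR : ℝ, 0 < μ₁ ∧ 0 < μR ∧ PureMarginStabilityAt (3 / 2000) μ₁ μR 4) (hR : AffineChartStraightening)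
    (hCP : NearBlockEquilibrium (3 / 2000) 4 6 (1 / 1000) 12 (1 / 25) (1 / 2000))
    (hR0 : NearBlockFloor (3 / 2000) 4 6 (1 / 1000) 12 (1 / 25) (1 / 2000) (1 / (4 * 10 ^ 7)))
    (h2 : NearSecondOrderFloor (3 / 2000) 4 6 (1 / 1000) 12 (1 / 25) (1 / 2000) (1 / (4 * 10 ^ 7)))
    (hZ : FarAggregatePricing 12 (1 / 25) (1 / 2000) (1 / (2 * 10 ^ 7))) (hM : AffMidAll 12 (1 / 25)) :
    TameBalancedDeepScaleGap (122 / 125) 0 4 (3 / 50) (1 / 450) :=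
  tbdsg_of_nearCritical_record'_bt_d hK hR (nearReferenceCritical_of_blockMean hK hCP hR0) h2 hZ hM

/-- **The residual RDEF through block-mean equilibria** (record shape; slot 3 = `K_at⁰ ∧ R_aff ∧ CPμ ∧ R0μ ∧ N2 ∧ Z ∧ M`). [this file] -/
theorem rdef_of_ceg_shape_nearBlockMean_record (hCEG : ChargedEnergyGap) (hT : TwoShellShape (1 / 100) (3 / 50) (1 / 450))
    (hK : ∃ μ₁ μR : ℝ, 0 < μ₁ ∧ 0 < μR ∧ PureMarginStabilityAt (3 / 2000) μ₁ μR 4) (hR : AffineChartStraightening)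
    (hCP : NearBlockEquilibrium (3 / 2000) 4 6 (1 / 1000) 12 (1 / 25) (1 / 2000))
    (hR0 : NearBlockFloor (3 / 2000) 4 6 (1 / 1000) 12 (1 / 25) (1 / 2000) (1 / (4 * 10 ^ 7)))
    (h2 : NearSecondOrderFloor (3 / 2000) 4 6 (1 / 1000) 12 (1 / 25) (1 / 2000) (1 / (4 * 10 ^ 7)))
    (hZ : FarAggregatePricing 12 (1 / 25) (1 / 2000) (1 / (2 * 10 ^ 7))) (hM : AffMidAll 12 (1 / 25))
    (hCE : CleanlessExcessT) (hRes : CoherentResidual 10) : RobustDefectLimitWindows :=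
  rdef_of_ceg_shape_balancedDeep_record hCEG hT (tbdsg_of_nearBlockMean_record hK hR hCP hR0 h2 hZ hM) hCE hRes

end Summit.AtomisticToContinuum.Crystallization.Theorems.OverbindingBudgetAffineNearCluster
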